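import Mathlib.MeasureTheory.Integral.IntervalIntegral.Basic
import Literature.Analysis.FluidPDE.HardSphereTimeScaling
import HarnessLib

/-!
# Galilean boosts of hard-sphere trajectories on the torus (helper, layer 1: deterministic)

Crux `Summit.AtomisticToContinuum.HydrodynamicLimit.Theses.AntiMazurCoboundaries.KineticWindowGronwall`
(stmt-AtomisticToContinuum-9282), line `dlr-block-transfer` v6, helper stub `stub_boostTrajectory` of the lead's stub
`stub_frameCovariance` (frame covariance of the kinetic input: the constants of the kinetic LD bound are universal in
the frame `(a, θ, u₀)` by exact symmetries of the hard-sphere dynamics — activity dummy, thermal scaling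
(`…KineticWindowGronwallThermalScaling{Trajectory,Flow,Gibbs}`) and the GALILEAN BOOST of this file).

THE SYMMETRY. On the flat torus `𝕋ᵈ = UnitAddTorus d` the Galilean boost by the velocity `u ∈ ℝᵈ` acts at time
`t` on a configuration `z = (x_i, v_i)_i` by `boostAt u t z = (x_i + t u (mod ℤᵈ), v_i + u)_i` (positions through
the torus geometry's `translate`, i.e. `x + Torus.proj (t • u)`). A common translation of all positions does not
change the minimal-image separation vectors, and a common translation of all velocities does not change relative
velocities; hence the hard-sphere domain, the contact sets, incoming/outgoing pairs and the elastic reflection law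
(which acts on the relative velocity of the colliding pair along the separation vector) are boost-invariant, free
flight is boost-covariant (`S_s ∘ boostAt u t = boostAt u (t + s) ∘ S_s`, from `Geometry.translate_add`), and the
collision times of the boosted curve `t ↦ boostAt u t (γ t)` are those of `γ`. Consequently the boosted curve of
a hard-sphere trajectory is a hard-sphere trajectory (`isHardSphereTrajectory_boostAt`; left limits are carried
along by the joint continuity of `(t, z) ↦ boostAt u t z`). Folklore (Galilean invariance of Newtonian hard-sphere
dynamics; GST 2013 §1.1, CIP 1994 §4.2).

CONTENTS: `boostAt` and its kinematic API (`boostAt_apply`, group law `boostAt_boostAt`, inverses, time `0`,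
`sepVec_boostAt`, domain / contact / incoming / outgoing invariance, `collidePair_boostAt`, `freeFlight_boostAt`,
`collisionTimes_boostAt`, `numCollisions_boostAt`, continuity, measurability, left limits `leftLim_boostAt`,
`velocityJump_boostAt`, `collisionPayload_boostAt`, momentum / energy formulas), the registered statement
`BoostTrajectory`, its proof `stub_boostTrajectory` (`isHardSphereTrajectory_boostAt`) and the converse
`isHardSphereTrajectory_boostAt_iff`.

CAVEAT FOR THE FLOW LEVEL (layer 2). The boost acts on curves by the TIME-DEPENDENT maps `boostAt u t`, so the
conjugate `t ↦ boostAt u t ∘ Φ_t ∘ boostAt (-u) 0` of a hard-sphere flow `Φ` is a one-parameter group only where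
`Φ` commutes with the position translations `boostAt (-u) 0 ∘ boostAt u t` (`boostAt_neg_zero_boostAt`).
-/

noncomputable section

open Set Filter Function MeasureTheory
open scoped Topology InnerProductSpace
open Literature.Analysis
open Literature.Analysis.FluidPDE

namespace Summit.AtomisticToContinuum.HydrodynamicLimit.Theorems.KineticWindowGronwallBoost

variable {d : Type*} [Fintype d] {N : ℕ}

/-- Galilean boost on the flat torus at time `t` by the velocity `u`: positions translated by `t • u` (mod ℤᵈ, through the torus geometry's `translate`), velocities by `u`. -/
def boostAt (u : EuclideanSpace ℝ d) (t : ℝ) (z : Config N d (UnitAddTorus d)) : Config N d (UnitAddTorus d) :=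
  fun i => ((Torus.geometry d).translate (z i).1 (t • u), (z i).2 + u)

/-- GALILEAN COVARIANCE OF HARD-SPHERE TRAJECTORIES ON THE TORUS. -/
def BoostTrajectory : Prop :=
  ∀ {d : Type*} [Fintype d] (ε : ℝ) (N : ℕ) (u : EuclideanSpace ℝ d) (γ : ℝ → Config N d (UnitAddTorus d)),
    IsHardSphereTrajectory (Torus.geometry d) ε N γ →
    IsHardSphereTrajectory (Torus.geometry d) ε N (fun t => boostAt u t (γ t))

/-! ### Kinematics of the boost -/

/-- Unfolding lemma: `boostAt u t z i = (x_i + proj (t • u), v_i + u)`. [folklore] -/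
@[simp]
theorem boostAt_apply (u : EuclideanSpace ℝ d) (t : ℝ) (z : Config N d (UnitAddTorus d)) (i : Fin N) :
    boostAt u t z i = ((z i).1 + FunctionSpaces.Torus.proj (t • u), (z i).2 + u) := rfl

/-- The position of particle `i` after the boost. [folklore] -/
theorem boostAt_apply_fst (u : EuclideanSpace ℝ d) (t : ℝ) (z : Config N d (UnitAddTorus d)) (i : Fin N) :
    (boostAt u t z i).1 = (z i).1 + FunctionSpaces.Torus.proj (t • u) := rfl

/-- The velocity of particle `i` after the boost: `v_i + u`. [folklore] -/
theorem boostAt_apply_snd (u : EuclideanSpace ℝ d) (t : ℝ) (z : Config N d (UnitAddTorus d)) (i : Fin N) :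
    (boostAt u t z i).2 = (z i).2 + u := rfl

/-- The boost through the torus geometry's `translate` (the defining formula). [folklore] -/
theorem boostAt_eq_translate (u : EuclideanSpace ℝ d) (t : ℝ) (z : Config N d (UnitAddTorus d)) :
    boostAt u t z = fun i => ((Torus.geometry d).translate (z i).1 (t • u), (z i).2 + u) := rfl

/-- Boosting by the zero velocity does nothing. [folklore] -/
@[simp]
theorem boostAt_zero_left (t : ℝ) (z : Config N d (UnitAddTorus d)) :
    boostAt (0 : EuclideanSpace ℝ d) t z = z := by
  funext i
  simp

/-- At time `0` the boost is the pure velocity translation `(x_i, v_i) ↦ (x_i, v_i + u)`. [folklore] -/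
theorem boostAt_zero_right (u : EuclideanSpace ℝ d) (z : Config N d (UnitAddTorus d)) :
    boostAt u 0 z = fun i => ((z i).1, (z i).2 + u) := by
  funext i
  simp

/-- Group law at a fixed time: boosting by `u'` and then by `u` is boosting by `u + u'`. [folklore] -/
theorem boostAt_boostAt (u u' : EuclideanSpace ℝ d) (t : ℝ) (z : Config N d (UnitAddTorus d)) :
    boostAt u t (boostAt u' t z) = boostAt (u + u') t z := by
  funext i
  simp only [boostAt_apply, smul_add, FunctionSpaces.Torus.proj_add, Prod.mk.injEq]
  constructor <;> abel

/-- The boost by `-u` undoes the boost by `u` (same time). [folklore] -/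
@[simp]
theorem boostAt_neg_boostAt (u : EuclideanSpace ℝ d) (t : ℝ) (z : Config N d (UnitAddTorus d)) :
    boostAt (-u) t (boostAt u t z) = z := by
  rw [boostAt_boostAt, neg_add_cancel, boostAt_zero_left]

/-- The boost by `u` undoes the boost by `-u` (same time). [folklore] -/
@[simp]
theorem boostAt_boostAt_neg (u : EuclideanSpace ℝ d) (t : ℝ) (z : Config N d (UnitAddTorus d)) :
    boostAt u t (boostAt (-u) t z) = z := by
  rw [boostAt_boostAt, add_neg_cancel, boostAt_zero_left]

/-- `boostAt u t` is injective. [folklore] -/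
theorem boostAt_injective (u : EuclideanSpace ℝ d) (t : ℝ) :
    Function.Injective (boostAt u t : Config N d (UnitAddTorus d) → Config N d (UnitAddTorus d)) :=
  fun z z' h => by rw [← boostAt_neg_boostAt u t z, h, boostAt_neg_boostAt]

/-- `boostAt u t` is surjective. [folklore] -/
theorem boostAt_surjective (u : EuclideanSpace ℝ d) (t : ℝ) :
    Function.Surjective (boostAt u t : Config N d (UnitAddTorus d) → Config N d (UnitAddTorus d)) :=
  fun z => ⟨boostAt (-u) t z, boostAt_boostAt_neg u t z⟩

/-- The image of a set under `boostAt u t` is its preimage under the inverse boost `boostAt (-u) t`. [folklore] -/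
theorem image_boostAt_eq_preimage (u : EuclideanSpace ℝ d) (t : ℝ) (s : Set (Config N d (UnitAddTorus d))) :
    boostAt u t '' s = boostAt (-u) t ⁻¹' s :=
  congrFun (Set.image_eq_preimage_of_inverse (boostAt_neg_boostAt u t) (boostAt_boostAt_neg u t)) s

/-- Boosts at two different times differ by a common translation of all positions:
`boostAt (-u) s (boostAt u t z) = (x_i + proj ((t - s) • u), v_i)_i`. [folklore] -/
theorem boostAt_neg_boostAt_of_ne (u : EuclideanSpace ℝ d) (s t : ℝ) (z : Config N d (UnitAddTorus d)) :
    boostAt (-u) s (boostAt u t z) = fun i => ((z i).1 + FunctionSpaces.Torus.proj ((t - s) • u), (z i).2) := by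
  funext i
  simp only [boostAt_apply, sub_eq_add_neg, add_smul, neg_smul, smul_neg, FunctionSpaces.Torus.proj_add,
    FunctionSpaces.Torus.proj_neg, add_neg_cancel_right, Prod.mk.injEq, and_true]
  abel

/-- In particular `boostAt (-u) 0 ∘ boostAt u t` is the translation of all positions by `t u`. [folklore] -/
theorem boostAt_neg_zero_boostAt (u : EuclideanSpace ℝ d) (t : ℝ) (z : Config N d (UnitAddTorus d)) :
    boostAt (-u) 0 (boostAt u t z) = fun i => ((z i).1 + FunctionSpaces.Torus.proj (t • u), (z i).2) := by
  rw [boostAt_neg_boostAt_of_ne, sub_zero]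

/-- A boost at time `t` is the velocity translation at time `0` followed by the translation of all positions by
`t u`. [folklore] -/
theorem boostAt_eq_posShift_boostAt_zero (u : EuclideanSpace ℝ d) (t : ℝ) (z : Config N d (UnitAddTorus d)) :
    boostAt u t z = fun i => ((boostAt u 0 z i).1 + FunctionSpaces.Torus.proj (t • u), (boostAt u 0 z i).2) := by
  funext i
  simp

/-! ### Invariance of separations, contacts and the collision law -/

/-- The minimal-image separation vectors are boost-invariant (all positions move by the same vector). [folklore] -/
@[simp]
theorem sepVec_boostAt (u : EuclideanSpace ℝ d) (t : ℝ) (z : Config N d (UnitAddTorus d)) (i j : Fin N) :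
    (Torus.geometry d).sepVec (boostAt u t z i).1 (boostAt u t z j).1 = (Torus.geometry d).sepVec (z i).1 (z j).1 := by
  simp only [boostAt_apply, Torus.geometry_sepVec, add_sub_add_right_eq_sub]

/-- Relative velocities are boost-invariant. [folklore] -/
@[simp]
theorem vel_sub_vel_boostAt (u : EuclideanSpace ℝ d) (t : ℝ) (z : Config N d (UnitAddTorus d)) (i j : Fin N) :
    (boostAt u t z i).2 - (boostAt u t z j).2 = (z i).2 - (z j).2 := by
  simp only [boostAt_apply, add_sub_add_right_eq_sub]

/-- The hard-sphere domain is boost-invariant. [folklore] -/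
@[simp]
theorem boostAt_mem_hardSphereDomain_iff {ε : ℝ} {u : EuclideanSpace ℝ d} {t : ℝ} {z : Config N d (UnitAddTorus d)} :
    boostAt u t z ∈ hardSphereDomain (Torus.geometry d) N ε ↔ z ∈ hardSphereDomain (Torus.geometry d) N ε := by
  simp only [mem_hardSphereDomain, sepVec_boostAt]

/-- The hard-sphere domain is boost-invariant (preimage form). [folklore] -/
theorem preimage_boostAt_hardSphereDomain (ε : ℝ) (u : EuclideanSpace ℝ d) (t : ℝ) :
    boostAt u t ⁻¹' hardSphereDomain (Torus.geometry d) N ε = hardSphereDomain (Torus.geometry d) N ε := by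
  ext z
  rw [mem_preimage]
  exact boostAt_mem_hardSphereDomain_iff (u := u) (t := t) (z := z)

/-- Contact sets are boost-invariant. [folklore] -/
@[simp]
theorem boostAt_mem_contactSet_iff {ε : ℝ} {u : EuclideanSpace ℝ d} {t : ℝ} {i j : Fin N}
    {z : Config N d (UnitAddTorus d)} :
    boostAt u t z ∈ contactSet (Torus.geometry d) N ε i j ↔ z ∈ contactSet (Torus.geometry d) N ε i j := by
  simp only [mem_contactSet, boostAt_mem_hardSphereDomain_iff, sepVec_boostAt]

/-- The normal relative velocity of a pair is boost-invariant. [folklore] -/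
theorem inner_sepVec_boostAt (u : EuclideanSpace ℝ d) (t : ℝ) (z : Config N d (UnitAddTorus d)) (i j : Fin N) :
    ⟪(Torus.geometry d).sepVec (boostAt u t z i).1 (boostAt u t z j).1, (boostAt u t z i).2 - (boostAt u t z j).2⟫_ℝ =
      ⟪(Torus.geometry d).sepVec (z i).1 (z j).1, (z i).2 - (z j).2⟫_ℝ := by
  rw [sepVec_boostAt, vel_sub_vel_boostAt]

/-- Incoming pairs are boost-invariant. [folklore] -/
@[simp]
theorem isIncoming_boostAt_iff {u : EuclideanSpace ℝ d} {t : ℝ} {z : Config N d (UnitAddTorus d)} {i j : Fin N} :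
    IsIncoming (Torus.geometry d) (boostAt u t z) i j ↔ IsIncoming (Torus.geometry d) z i j := by
  rw [IsIncoming, IsIncoming, inner_sepVec_boostAt]

/-- Outgoing pairs are boost-invariant. [folklore] -/
@[simp]
theorem isOutgoing_boostAt_iff {u : EuclideanSpace ℝ d} {t : ℝ} {z : Config N d (UnitAddTorus d)} {i j : Fin N} :
    IsOutgoing (Torus.geometry d) (boostAt u t z) i j ↔ IsOutgoing (Torus.geometry d) z i j := by
  rw [IsOutgoing, IsOutgoing, inner_sepVec_boostAt]

/-- Grazing pairs are boost-invariant. [folklore] -/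
@[simp]
theorem isGrazing_boostAt_iff {u : EuclideanSpace ℝ d} {t : ℝ} {z : Config N d (UnitAddTorus d)} {i j : Fin N} :
    IsGrazing (Torus.geometry d) (boostAt u t z) i j ↔ IsGrazing (Torus.geometry d) z i j := by
  rw [IsGrazing, IsGrazing, inner_sepVec_boostAt]

/-- The elastic reflection law is covariant under a common translation of the two velocities (it acts on the
relative velocity). [folklore] -/
theorem reflectVel_add_right (n v w u : EuclideanSpace ℝ d) :
    reflectVel n (v + u, w + u) = ((reflectVel n (v, w)).1 + u, (reflectVel n (v, w)).2 + u) := by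
  simp only [reflectVel, add_sub_add_right_eq_sub, Prod.mk.injEq]
  constructor <;> abel

/-- **The elastic collision of a pair commutes with the boost** (the impact direction and the relative velocity
are unchanged, and the reflection law translates with the velocities). [folklore] -/
theorem collidePair_boostAt (u : EuclideanSpace ℝ d) (t : ℝ) (i j : Fin N) (z : Config N d (UnitAddTorus d)) :
    collidePair (Torus.geometry d) i j (boostAt u t z) = boostAt u t (collidePair (Torus.geometry d) i j z) := by
  have hn : (Torus.geometry d).sepVec ((z i).1 + FunctionSpaces.Torus.proj (t • u))
      ((z j).1 + FunctionSpaces.Torus.proj (t • u)) = (Torus.geometry d).sepVec (z i).1 (z j).1 :=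
    sepVec_boostAt u t z i j
  funext k
  by_cases hkj : k = j
  · subst hkj
    simp only [boostAt_apply, collidePair_apply_right, hn, reflectVel_add_right]
  by_cases hki : k = i
  · subst hki
    simp only [boostAt_apply, collidePair_apply_left hkj, hn, reflectVel_add_right]
  simp only [boostAt_apply, collidePair_apply_of_ne hki hkj]

/-! ### Free flight, collision times -/

/-- **Free flight is boost-covariant**: `S_s (boostAt u t z) = boostAt u (t + s) (S_s z)` — flying for time `s`
with velocities `v_i + u` moves the positions by the extra common vector `s u` (`Geometry.translate_add`). [folklore] -/
theorem freeFlight_boostAt (u : EuclideanSpace ℝ d) (t s : ℝ) (z : Config N d (UnitAddTorus d)) :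
    freeFlight (Torus.geometry d) s (boostAt u t z) = boostAt u (t + s) (freeFlight (Torus.geometry d) s z) := by
  funext i
  simp only [freeFlight_apply, boostAt_apply, Torus.geometry_translate, smul_add, add_smul,
    FunctionSpaces.Torus.proj_add, Prod.mk.injEq, and_true]
  abel

/-- The same with the boost on the right at time `t - s`: `boostAt u t (S_s z) = S_s (boostAt u (t - s) z)`. [folklore] -/
theorem boostAt_freeFlight (u : EuclideanSpace ℝ d) (t s : ℝ) (z : Config N d (UnitAddTorus d)) :
    boostAt u t (freeFlight (Torus.geometry d) s z) = freeFlight (Torus.geometry d) s (boostAt u (t - s) z) := by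
  rw [freeFlight_boostAt, sub_add_cancel]

/-- **The collision times of the boosted curve are those of the curve** (contact only sees separations). [folklore] -/
@[simp]
theorem collisionTimes_boostAt (ε : ℝ) (u : EuclideanSpace ℝ d) (γ : ℝ → Config N d (UnitAddTorus d)) :
    collisionTimes (Torus.geometry d) ε (fun t => boostAt u t (γ t)) = collisionTimes (Torus.geometry d) ε γ := by
  ext t
  simp only [mem_collisionTimes, boostAt_mem_contactSet_iff]

/-- The number of collisions in a window is boost-invariant. [folklore] -/
@[simp]
theorem numCollisions_boostAt (ε : ℝ) (u : EuclideanSpace ℝ d) (γ : ℝ → Config N d (UnitAddTorus d)) (a b : ℝ) :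
    numCollisions (Torus.geometry d) ε (fun t => boostAt u t (γ t)) a b = numCollisions (Torus.geometry d) ε γ a b := by
  rw [numCollisions, numCollisions, collisionTimes_boostAt]

/-! ### Momentum and energy -/

/-- The total momentum is translated by `N u`. [folklore] -/
theorem configMomentum_boostAt (u : EuclideanSpace ℝ d) (t : ℝ) (z : Config N d (UnitAddTorus d)) :
    configMomentum (boostAt u t z) = configMomentum z + N • u := by
  simp only [configMomentum, boostAt_apply, Finset.sum_add_distrib, Finset.sum_const, Finset.card_univ,
    Fintype.card_fin]

/-- The kinetic energy in the boosted frame: `E(boostAt u t z) = E(z) + ⟪P(z), u⟫ + N |u|² / 2`. [folklore] -/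
theorem configEnergy_boostAt (u : EuclideanSpace ℝ d) (t : ℝ) (z : Config N d (UnitAddTorus d)) :
    configEnergy (boostAt u t z) = configEnergy z + ⟪configMomentum z, u⟫_ℝ + N * ‖u‖ ^ 2 / 2 := by
  have h : ∀ i : Fin N, ‖(z i).2 + u‖ ^ 2 = ‖(z i).2‖ ^ 2 + 2 * ⟪(z i).2, u⟫_ℝ + ‖u‖ ^ 2 := fun i =>
    norm_add_sq_real _ _
  simp only [configEnergy, configMomentum, boostAt_apply, h, Finset.sum_add_distrib, Finset.sum_const,
    Finset.card_univ, Fintype.card_fin, sum_inner, ← Finset.mul_sum, nsmul_eq_mul]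
  ring

/-! ### Continuity and measurability -/

/-- The boost is jointly continuous in the time and the configuration. [folklore] -/
theorem continuous_boostAt (u : EuclideanSpace ℝ d) :
    Continuous fun p : ℝ × Config N d (UnitAddTorus d) => boostAt u p.1 p.2 := by
  refine continuous_pi fun i => ?_
  have hi : Continuous fun p : ℝ × Config N d (UnitAddTorus d) => p.2 i := (continuous_apply i).comp continuous_snd
  exact (hi.fst.add (FunctionSpaces.Torus.continuous_proj.comp (continuous_fst.smul continuous_const))).prodMk
    (hi.snd.add continuous_const)

/-- Each `boostAt u t` is continuous. [folklore] -/
theorem continuous_boostAt_right (u : EuclideanSpace ℝ d) (t : ℝ) :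
    Continuous (boostAt u t : Config N d (UnitAddTorus d) → Config N d (UnitAddTorus d)) :=
  (continuous_boostAt u).comp (Continuous.prodMk_right t)

/-- The boost of a fixed configuration is continuous in time. [folklore] -/
theorem continuous_boostAt_left (u : EuclideanSpace ℝ d) (z : Config N d (UnitAddTorus d)) :
    Continuous fun t : ℝ => boostAt u t z :=
  (continuous_boostAt u).comp (Continuous.prodMk_left z)

/-- Each `boostAt u t` is measurable. [folklore] -/
theorem measurable_boostAt (u : EuclideanSpace ℝ d) (t : ℝ) :
    Measurable (boostAt u t : Config N d (UnitAddTorus d) → Config N d (UnitAddTorus d)) :=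
  measurable_pi_lambda _ fun i =>
    ((measurable_pi_apply i).fst.add_const _).prodMk ((measurable_pi_apply i).snd.add_const u)

/-! ### Left limits along boosted curves -/

/-- Limits from the left are carried along the boost: if `γ τ → zl` as `τ ↑ t` then
`boostAt u τ (γ τ) → boostAt u t zl`. [folklore] -/
theorem tendsto_boostAt_nhdsLT (u : EuclideanSpace ℝ d) {γ : ℝ → Config N d (UnitAddTorus d)} {t : ℝ}
    {zl : Config N d (UnitAddTorus d)} (h : Tendsto γ (𝓝[<] t) (𝓝 zl)) :
    Tendsto (fun τ => boostAt u τ (γ τ)) (𝓝[<] t) (𝓝 (boostAt u t zl)) := by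
  have hτ : Tendsto (fun τ : ℝ => τ) (𝓝[<] t) (𝓝 t) := Filter.tendsto_id'.2 nhdsWithin_le_nhds
  exact ((continuous_boostAt u).tendsto (t, zl)).comp (hτ.prodMk_nhds h)

/-- Conversely, left limits of the boosted curve give left limits of the curve (boost back by `-u`). [folklore] -/
theorem tendsto_nhdsLT_of_boostAt (u : EuclideanSpace ℝ d) {γ : ℝ → Config N d (UnitAddTorus d)} {t : ℝ}
    {w : Config N d (UnitAddTorus d)} (h : Tendsto (fun τ => boostAt u τ (γ τ)) (𝓝[<] t) (𝓝 w)) :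
    Tendsto γ (𝓝[<] t) (𝓝 (boostAt (-u) t w)) := by
  refine (tendsto_boostAt_nhdsLT (-u) h).congr fun τ => ?_
  simp only [boostAt_neg_boostAt]

/-- **Left limits of the boosted curve**: `(boost γ)(t⁻) = boostAt u t (γ(t⁻))`. [folklore] -/
theorem leftLim_boostAt (u : EuclideanSpace ℝ d) (γ : ℝ → Config N d (UnitAddTorus d)) (t : ℝ) :
    leftLim (fun τ => boostAt u τ (γ τ)) t = boostAt u t (leftLim γ t) := by
  by_cases hγ : ∃ y, Tendsto γ (𝓝[<] t) (𝓝 y)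
  · obtain ⟨y, hy⟩ := hγ
    rw [leftLim_eq_of_tendsto hy, leftLim_eq_of_tendsto (tendsto_boostAt_nhdsLT u hy)]
  · rw [leftLim_eq_of_not_tendsto _ hγ, leftLim_eq_of_not_tendsto]
    rintro ⟨w, hw⟩
    exact hγ ⟨boostAt (-u) t w, tendsto_nhdsLT_of_boostAt u hw⟩

/-- Velocity jumps are boost-invariant. [folklore] -/
@[simp]
theorem velocityJump_boostAt (u : EuclideanSpace ℝ d) (γ : ℝ → Config N d (UnitAddTorus d)) (t : ℝ) :
    velocityJump (fun τ => boostAt u τ (γ τ)) t = velocityJump γ t := by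
  simp only [velocityJump, leftLim_boostAt, boostAt_apply, add_sub_add_right_eq_sub]

/-- The collision payload of a window is boost-invariant. [folklore] -/
@[simp]
theorem collisionPayload_boostAt (ε : ℝ) (u : EuclideanSpace ℝ d) (γ : ℝ → Config N d (UnitAddTorus d))
    (a b : ℝ) :
    collisionPayload (Torus.geometry d) ε (fun τ => boostAt u τ (γ τ)) a b =
      collisionPayload (Torus.geometry d) ε γ a b := by
  rw [collisionPayload_eq, collisionPayload_eq, collisionTimes_boostAt]
  exact finsum_mem_congr rfl fun s _ => velocityJump_boostAt u γ s

/-! ### Closure of hard-sphere trajectories under boosts -/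

/-- **The Galilean boost of a hard-sphere trajectory is a hard-sphere trajectory**: the boosted curve
`t ↦ boostAt u t (γ t)` stays in the domain, has the same (locally finite) collision times, continuous positions
`x_i(t) + t u`, is free flight between collisions (`freeFlight_boostAt`), and at a collision the left limit is the
boosted incoming left limit of `γ` whose elastic reflection is the boosted value (`collidePair_boostAt`).
Galilean invariance of the hard-sphere dynamics (GST 2013 §1.1; CIP 1994 §4.2). [folklore] -/
theorem isHardSphereTrajectory_boostAt {ε : ℝ} {γ : ℝ → Config N d (UnitAddTorus d)} (u : EuclideanSpace ℝ d)
    (h : IsHardSphereTrajectory (Torus.geometry d) ε N γ) :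
    IsHardSphereTrajectory (Torus.geometry d) ε N (fun t => boostAt u t (γ t)) where
  mem t := boostAt_mem_hardSphereDomain_iff.2 (h.mem t)
  locFinite a b := by
    rw [collisionTimes_boostAt]
    exact h.locFinite a b
  pos_continuous i :=
    (h.pos_continuous i).add (FunctionSpaces.Torus.continuous_proj.comp (continuous_id.smul continuous_const))
  free s t hst hfree := by
    rw [collisionTimes_boostAt] at hfree
    show boostAt u t (γ t) = freeFlight (Torus.geometry d) (t - s) (boostAt u s (γ s))
    rw [h.free s t hst hfree, freeFlight_boostAt, add_sub_cancel]
  binary t i j hij hct := by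
    have hct' : γ t ∈ contactSet (Torus.geometry d) N ε i j := boostAt_mem_contactSet_iff.1 hct
    obtain ⟨huniq, zl, hzl, hin, hγ⟩ := h.binary t i j hij hct'
    refine ⟨fun i' j' hij' hmem => huniq i' j' hij' (boostAt_mem_contactSet_iff.1 hmem), boostAt u t zl,
      tendsto_boostAt_nhdsLT u hzl, isIncoming_boostAt_iff.2 hin, ?_⟩
    show boostAt u t (γ t) = collidePair (Torus.geometry d) i j (boostAt u t zl)
    rw [hγ, collidePair_boostAt]

/-- Undoing a boost: `γ` is recovered from its boosted curve by the boost by `-u`. [folklore] -/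
theorem boostAt_neg_boostAt_curve (u : EuclideanSpace ℝ d) (γ : ℝ → Config N d (UnitAddTorus d)) :
    (fun t => boostAt (-u) t (boostAt u t (γ t))) = γ := by
  funext t
  exact boostAt_neg_boostAt u t (γ t)

/-- A curve is a hard-sphere trajectory iff its boosted curve is. [folklore] -/
theorem isHardSphereTrajectory_boostAt_iff {ε : ℝ} {γ : ℝ → Config N d (UnitAddTorus d)} (u : EuclideanSpace ℝ d) :
    IsHardSphereTrajectory (Torus.geometry d) ε N (fun t => boostAt u t (γ t)) ↔
      IsHardSphereTrajectory (Torus.geometry d) ε N γ := by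
  refine ⟨fun h => ?_, isHardSphereTrajectory_boostAt u⟩
  have h' := isHardSphereTrajectory_boostAt (-u) h
  simp only [boostAt_neg_boostAt] at h'
  exact h'

/-! ### The registered statement -/

/-- **Layer 1 of the Galilean boost, proved**: `stub_boostTrajectory` (`isHardSphereTrajectory_boostAt`). [folklore] -/
theorem stub_boostTrajectory : BoostTrajectory := by
  intro d _ ε N u γ h
  exact isHardSphereTrajectory_boostAt u h

/-- The torus-`Fin 3` specialisation in the form used by the frame covariance. [folklore] -/
theorem boostTrajectory_torus (ε : ℝ) (N : ℕ) (u : EuclideanSpace ℝ (Fin 3))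
    (γ : ℝ → Config N (Fin 3) (UnitAddTorus (Fin 3))) (h : IsHardSphereTrajectory (Torus.geometry (Fin 3)) ε N γ) :
    IsHardSphereTrajectory (Torus.geometry (Fin 3)) ε N (fun t => boostAt u t (γ t)) :=
  isHardSphereTrajectory_boostAt u h

end Summit.AtomisticToContinuum.HydrodynamicLimit.Theorems.KineticWindowGronwallBoost

end
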